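import Mathlib.Logic.Function.Basic
import HarnessLib

/-!
# Sheet transport: identities proved on the image of ONE reading `red₀ ∘ ℓ_e` hold on every special point
# (pure logic over an abstract deck action, a cover by deck-translates of one sheet, and equivariant data)

Topic `Literature/AlgebraicGeometry/Motives`, namespace `Literature.AlgebraicGeometry.Motives.SheetTransport`.  THEOREMS ONLY
(no definition, no instance, no notation, no named fact, no `sorry`); NO geometry is imported: every object is an abstract
type or function, and the consumers instantiate the binders by `exact` from ★ statements.  Cell `hodgecm-mathlib` (D-0151),
P6 «MOD programme» (crux hLiu418 = stmt-HodgeConjecture-24832, `--supports`), LEAD F0P6-plan (g0) ruling M-13 (4) organ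
**«TRANSPORT»** (dealt to B-p18 (g35)), implementing M-12b (c) «HEART-FROB′ is stated on ONE sheet (image of `red₀ ∘ ℓ_e`) and
transported to all of `P₀` by θ-equivariance + SHEET-COVER» and F0P6c-plan «SHEETS-2» («θ-equivariance of `Fr₀` is exactly
what transports (c3a)(c3b)(c3c) from sheet `e` to all of `P₀` via SHEET-COVER»).  HC_CM is proved only modulo the printed
citations until rung 0 closes; nothing in this file is about HC.

THE SITUATION ABSTRACTED.  In the heart of the MOD road one has: the `κ̄(w)`-points `P₀` of the special fibre of a proper
flat model `𝓨` of the Galois thickening `R_{Fᵢ} M` (★ `Motives/GaloisThickening`), acted on by the deck group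
`Γ = Aut(Fᵢ ∕ F)` through `θ(γ, 1)_s` (here: an abstract map `act : Γ → P → P`; NO group law is used); ONE reading
`r := red_𝓨 ∘ ℓ_e : M(Ω) → P₀` of the generic points through the sheet `e` (here: `r : A → P`); the SHEET-COVER theorem ★
`IntegralModel.exists_aut_geomReductionMap_thickeningLift_eq` («every `x̄ ∈ P₀` is `θ(γ,1)_s (red_𝓨 (ℓ_e P))`», [SerreTate1968]
§1 Lemma 2 + [SGA1] V §1; here: `hcover : ∀ x, ∃ γ a, x = act γ (r a)`); the sheet-wise shadow of Frobenius `Fr₀`, which is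
θ-EQUIVARIANT (★ `IntegralModel.exists_sheetwise_frobeniusShadow` (iii): `Fr₀ (θ(γ)_s p) = θ(γ)_s (Fr₀ p)`; here `hFr`), and
reads the arithmetic Frobenius on the sheet (loc. cit. (ii): `Fr₀ (red (ℓ_e P)) = red (ℓ_e (σ • P))`; here `hread : Fr (r a) =
r (σA a)`); and the moduli operations of the isogeny dictionary (`Lines/F0_P6c_IsogenyDictionary.lean`, structure
`PointDictionary`: the dependent family `Sub x̄` of admissible subgroup schemes, `kerF x̄ ∈ Sub x̄`, the étale predicate, the
moduli quotient `quot x̄ H` and the ideal translation `transl`), which COMMUTE WITH THE GALOIS RELABELLING `θ(γ,1)` (LEAD M-12b (b):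
the `ModuliDatum` equivariance fields «`quot` ∕ admissible `H` ∕ `kerF` commute with `θ(γ,1)`»; here: a relabelling
`smap γ x : Sub x → Sub (act γ x)` with `hkerF`, `hquot`, `hEt`, `htransl`).  Every equivariance hypothesis is stated AT the
translated point `act γ x`, so no transport along equalities of points (no `cast`) is ever needed.

MAIN STATEMENTS.
* §1 masters: `forall_of_cover` (an `act`-stable property holding on the image of `r` holds everywhere) and its dependent form
  `forall_sub_of_cover` (properties of pairs `(x̄, H ∈ Sub x̄)`, needs the relabelling to be onto).
* §2 the dictionary sockets, token-shaped after `PointDictionary`: **`quot_kerF_of_cover`** ((c3a) `quot x̄ (kerF x̄) = Fr x̄`),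
  **`frob_quot_of_isEtale_of_cover`** ((c3b) `Fr (quot x̄ H) = transl x̄` for étale `H`), **`frob_frob_of_forall_not_isEtale_of_cover`**
  ((c3c) `Fr (Fr x̄) = transl x̄` at supersingular `x̄`), `eq_kerF_or_isEtale_of_cover` ((b) the dichotomy of subgroups) — each
  from the same identity on the image of `r`.
* §3 the ONE-SHEET bridge (M-12b (c)): from the READING `Fr (r a) = r (σA a)`, the commutation `r (quotΩ a ℓ) = quot (r a) (sp a ℓ)`
  of reduction with the moduli quotient ((c2) shape), the existence half of the canonical line ((b4′) shape) and the identity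
  HEART-FROB′ «`r (quotΩ a ℓ₀) = r (σA a)` for a line `ℓ₀` specialising to `kerF`» one gets (c3a) ON THE IMAGE of `r`
  (`quot_kerF_reading_of_heartFrob'`, the supersingular points being supplied separately), hence EVERYWHERE
  (`quot_kerF_of_heartFrob'`).

The mathematics is [SGA1] Exp. V §1 (the fibres of `X → X∕Γ` are the `Γ`-orbits, so `Γ`-invariant assertions descend ∕ extend
along orbits) applied to the congruence relation of [Liu2021] Prop. D.8 (3) (pp. 135, 137–138) in the isogeny-quotient form of
[HarrisTaylorAMS2001] §III.4 (pp. 108–110); the file isolates the bookkeeping so that the geometric inputs enter BY NAME.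

## References
* [SGA1] A. Grothendieck, *Revêtements étales et groupe fondamental (SGA 1)*, Exp. V §1 (schemes with a finite group of operators).
* [SerreTate1968] J.-P. Serre, J. Tate, *Good reduction of abelian varieties*, Ann. of Math. 88 (1968), §1 Lemma 2.
* [Liu2021] Y. Liu, *Fourier–Jacobi cycles and arithmetic relative trace formula*, Camb. J. Math. 9 (2021), App. D, Prop. D.8 (3).
* [HarrisTaylorAMS2001] M. Harris, R. Taylor, *The geometry and cohomology of some simple Shimura varieties* (2001), §III.4.
-/

set_option autoImplicit false

namespace Literature.AlgebraicGeometry.Motives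

namespace SheetTransport

universe u v w

variable {P : Type u} {Γ : Type v} {A : Type w}

/-! ## §1 Masters: `act`-stable properties holding on the image of the reading hold everywhere -/

/-- **Transport of an `act`-stable property off the image of one reading.**  If every point is a translate `act γ (r a)` of a
point of the image of `r` (SHEET-COVER shape), a property `C` stable under every `act γ` and true on the image of `r` is true
everywhere.  (Abstract form of ★ `IntegralModel.forall_specialPoint_of_forall_thickeningLift`.) [cite: SGA1, Exp. V §1] -/
theorem forall_of_cover (act : Γ → P → P) (r : A → P) (hcover : ∀ x : P, ∃ (γ : Γ) (a : A), x = act γ (r a))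
    {C : P → Prop} (hC : ∀ (γ : Γ) (x : P), C x → C (act γ x)) (h : ∀ a : A, C (r a)) (x : P) : C x := by
  obtain ⟨γ, a, rfl⟩ := hcover x
  exact hC γ _ (h a)

/-- **Transport of an `act`-stable property of pairs `(x, H)`**, `H` ranging over a DEPENDENT family `Sub x` relabelled along
`act` by `smap γ x : Sub x → Sub (act γ x)` («`H ↦ θ·H`»): if each relabelling is onto, a property stable under
`(x, H) ↦ (act γ x, smap γ x H)` and true over the image of `r` is true over every point. [cite: SGA1, Exp. V §1] -/
theorem forall_sub_of_cover (act : Γ → P → P) (r : A → P) (hcover : ∀ x : P, ∃ (γ : Γ) (a : A), x = act γ (r a))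
    {Sub : P → Type*} (smap : ∀ (γ : Γ) (x : P), Sub x → Sub (act γ x))
    (hsurj : ∀ (γ : Γ) (x : P), Function.Surjective (smap γ x))
    {C : ∀ x : P, Sub x → Prop} (hC : ∀ (γ : Γ) (x : P) (H : Sub x), C x H → C (act γ x) (smap γ x H))
    (h : ∀ (a : A) (H : Sub (r a)), C (r a) H) (x : P) (H : Sub x) : C x H := by
  obtain ⟨γ, a, rfl⟩ := hcover x
  obtain ⟨H₀, rfl⟩ := hsurj γ (r a) H
  exact hC γ _ H₀ (h a H₀)

/-- **An identity between two `act`-equivariant maps transports off the image of the reading**: if `f (act γ x) = act γ (f x)`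
and likewise for `g`, then `f = g` on the image of `r` implies `f = g` everywhere (the case `C x := (f x = g x)` of
`forall_of_cover`). [cite: SGA1, Exp. V §1] -/
theorem apply_eq_apply_of_cover (act : Γ → P → P) (r : A → P) (hcover : ∀ x : P, ∃ (γ : Γ) (a : A), x = act γ (r a))
    {f g : P → P} (hf : ∀ (γ : Γ) (x : P), f (act γ x) = act γ (f x)) (hg : ∀ (γ : Γ) (x : P), g (act γ x) = act γ (g x))
    (h : ∀ a : A, f (r a) = g (r a)) (x : P) : f x = g x := by
  refine forall_of_cover act r hcover (C := fun x => f x = g x) (fun γ x hx => ?_) h x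
  rw [hf, hg, hx]

/-! ## §2 The dictionary sockets (c3a), (c3b), (c3c), (b) transported off the image of the reading -/

section Sockets

variable (act : Γ → P → P) (r : A → P) {Sub : P → Type*} (smap : ∀ (γ : Γ) (x : P), Sub x → Sub (act γ x))

/-- **(c3a) transported: `quot x̄ (kerF x̄) = Fr x̄` everywhere**, from the same identity on the image of the reading `r`, the
cover by `act`-translates, and the equivariances of `Fr` (`hFr`, ★ sheet-wise shadow (iii)), of the Frobenius kernel
(`hkerF : kerF (act γ x) = smap γ x (kerF x)`) and of the moduli quotient (`hquot`).  This is the transport line of the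
derivation of [Liu2021] Prop. D.8 (3) «the quotient by the Frobenius kernel is the Frobenius» off the chosen sheet.
[cite: Liu2021, Prop. D.8 (3) p. 135, pp. 137–138] [cite: SGA1, Exp. V §1] -/
theorem quot_kerF_of_cover (hcover : ∀ x : P, ∃ (γ : Γ) (a : A), x = act γ (r a))
    (Fr : P → P) (hFr : ∀ (γ : Γ) (x : P), Fr (act γ x) = act γ (Fr x))
    (kerF : ∀ x : P, Sub x) (hkerF : ∀ (γ : Γ) (x : P), kerF (act γ x) = smap γ x (kerF x))
    (quot : ∀ x : P, Sub x → P) (hquot : ∀ (γ : Γ) (x : P) (H : Sub x), quot (act γ x) (smap γ x H) = act γ (quot x H))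
    (h : ∀ a : A, quot (r a) (kerF (r a)) = Fr (r a)) (x : P) : quot x (kerF x) = Fr x := by
  obtain ⟨γ, a, rfl⟩ := hcover x
  rw [hkerF, hquot, hFr, h]

/-- **(c3b) transported: `Fr (quot x̄ H) = transl x̄` for every ÉTALE `H ∈ Sub x̄`**, everywhere, from the same statement over the
image of the reading; needs the relabelling `smap γ x` to be onto (every admissible subgroup at `act γ x` comes from one at `x`)
and to reflect étaleness (`hEt`), plus the equivariances of `Fr`, `quot`, `transl`.
[cite: Liu2021, Prop. D.8 (3) p. 135, pp. 137–138] [cite: HarrisTaylorAMS2001, §III.4, pp. 108–110] -/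
theorem frob_quot_of_isEtale_of_cover (hcover : ∀ x : P, ∃ (γ : Γ) (a : A), x = act γ (r a))
    (hsurj : ∀ (γ : Γ) (x : P), Function.Surjective (smap γ x))
    (Fr : P → P) (hFr : ∀ (γ : Γ) (x : P), Fr (act γ x) = act γ (Fr x))
    (transl : P → P) (htransl : ∀ (γ : Γ) (x : P), transl (act γ x) = act γ (transl x))
    (quot : ∀ x : P, Sub x → P) (hquot : ∀ (γ : Γ) (x : P) (H : Sub x), quot (act γ x) (smap γ x H) = act γ (quot x H))
    (IsEtale : ∀ ⦃x : P⦄, Sub x → Prop) (hEt : ∀ (γ : Γ) (x : P) (H : Sub x), IsEtale (smap γ x H) → IsEtale H)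
    (h : ∀ (a : A) (H : Sub (r a)), IsEtale H → Fr (quot (r a) H) = transl (r a))
    (x : P) (H : Sub x) (hH : IsEtale H) : Fr (quot x H) = transl x := by
  obtain ⟨γ, a, rfl⟩ := hcover x
  obtain ⟨H₀, rfl⟩ := hsurj γ (r a) H
  rw [hquot, hFr, htransl, h a H₀ (hEt γ _ H₀ hH)]

/-- **(c3c) transported: at a SUPERSINGULAR point (no étale member of `Sub x̄`) `Fr (Fr x̄) = transl x̄`**, everywhere, from the same
statement over the image of the reading; needs the relabelling to preserve étaleness (`hEt`, so that a supersingular translate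
has a supersingular source) and the equivariances of `Fr` and `transl`.
[cite: Liu2021, Prop. D.8 (3) p. 135, pp. 137–138] [cite: HarrisTaylorAMS2001, §III.4, pp. 108–110] -/
theorem frob_frob_of_forall_not_isEtale_of_cover (hcover : ∀ x : P, ∃ (γ : Γ) (a : A), x = act γ (r a))
    (Fr : P → P) (hFr : ∀ (γ : Γ) (x : P), Fr (act γ x) = act γ (Fr x))
    (transl : P → P) (htransl : ∀ (γ : Γ) (x : P), transl (act γ x) = act γ (transl x))
    (IsEtale : ∀ ⦃x : P⦄, Sub x → Prop) (hEt : ∀ (γ : Γ) (x : P) (H : Sub x), IsEtale H → IsEtale (smap γ x H))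
    (h : ∀ a : A, (∀ H : Sub (r a), ¬ IsEtale H) → Fr (Fr (r a)) = transl (r a))
    (x : P) (hx : ∀ H : Sub x, ¬ IsEtale H) : Fr (Fr x) = transl x := by
  obtain ⟨γ, a, rfl⟩ := hcover x
  rw [hFr, hFr, htransl, h a (fun H hH => hx (smap γ (r a) H) (hEt γ _ H hH))]

/-- **(b) transported: every member of `Sub x̄` is the Frobenius kernel or étale**, everywhere, from the same dichotomy over the
image of the reading; needs the relabelling onto, preserving étaleness, and the equivariance of `kerF`.
[cite: Liu2021, Prop. D.8 (3) p. 135, pp. 137–138] [cite: HarrisTaylorAMS2001, §III.4, pp. 108–110] -/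
theorem eq_kerF_or_isEtale_of_cover (hcover : ∀ x : P, ∃ (γ : Γ) (a : A), x = act γ (r a))
    (hsurj : ∀ (γ : Γ) (x : P), Function.Surjective (smap γ x))
    (kerF : ∀ x : P, Sub x) (hkerF : ∀ (γ : Γ) (x : P), kerF (act γ x) = smap γ x (kerF x))
    (IsEtale : ∀ ⦃x : P⦄, Sub x → Prop) (hEt : ∀ (γ : Γ) (x : P) (H : Sub x), IsEtale H → IsEtale (smap γ x H))
    (h : ∀ (a : A) (H : Sub (r a)), H = kerF (r a) ∨ IsEtale H)
    (x : P) (H : Sub x) : H = kerF x ∨ IsEtale H := by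
  obtain ⟨γ, a, rfl⟩ := hcover x
  obtain ⟨H₀, rfl⟩ := hsurj γ (r a) H
  rcases h a H₀ with h₀ | h₀
  · exact Or.inl (by rw [h₀, hkerF])
  · exact Or.inr (hEt γ _ H₀ h₀)

/-- **A value of `transl` transported**: `transl x̄ = T x̄` everywhere for any second `act`-equivariant self-map `T` agreeing with
`transl` on the image of the reading (e.g. the reading of the central Hecke translate `⟨ϖ⟩` through `red₀`; the case `f := transl`,
`g := T` of `apply_eq_apply_of_cover`). [cite: HarrisTaylorAMS2001, §III.4, pp. 108–110] -/
theorem transl_eq_of_cover (hcover : ∀ x : P, ∃ (γ : Γ) (a : A), x = act γ (r a))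
    (transl T : P → P) (htransl : ∀ (γ : Γ) (x : P), transl (act γ x) = act γ (transl x))
    (hT : ∀ (γ : Γ) (x : P), T (act γ x) = act γ (T x)) (h : ∀ a : A, transl (r a) = T (r a)) (x : P) :
    transl x = T x :=
  apply_eq_apply_of_cover act r hcover htransl hT h x

end Sockets

/-! ## §3 The one-sheet bridge: HEART-FROB′ + the reading of Frobenius give (c3a) on the image, hence everywhere -/

section OneSheet

variable (r : A → P) {Sub : P → Type*} {Line : A → Type*}

/-- **(c3a) ON THE IMAGE OF THE READING from HEART-FROB′.**  Data over the sheet source `A` (the generic points read through the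
sheet `e`): the reading of Frobenius `hread : Fr (r a) = r (σA a)` (★ sheet-wise shadow (ii)), lines `Line a` with their
specialisation `sp a : Line a → Sub (r a)`, the generic moduli quotient `quotΩ`, the commutation of reduction with the quotient
`red_quotΩ : r (quotΩ a ℓ) = quot (r a) (sp a ℓ)` ((c2) shape), and the existence of a line specialising to the Frobenius kernel at
every ORDINARY image point (`hcan`, the existence half of the canonical line (b4′)).  Then the one-sheet congruence HEART-FROB′
«`r (quotΩ a ℓ₀) = r (σA a)` whenever `sp a ℓ₀ = kerF (r a)`» gives (c3a) `quot (r a) (kerF (r a)) = Fr (r a)` at every image point,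
the SUPERSINGULAR image points (no étale subgroup) being supplied by `hss`.
[cite: Liu2021, Prop. D.8 (3) p. 135, pp. 137–138] [cite: HarrisTaylorAMS2001, §III.4, pp. 108–110] -/
theorem quot_kerF_reading_of_heartFrob' (Fr : P → P) (σA : A → A) (hread : ∀ a : A, Fr (r a) = r (σA a))
    (kerF : ∀ x : P, Sub x) (quot : ∀ x : P, Sub x → P) (IsEtale : ∀ ⦃x : P⦄, Sub x → Prop)
    (sp : ∀ a : A, Line a → Sub (r a)) (quotΩ : ∀ a : A, Line a → A)
    (red_quotΩ : ∀ (a : A) (ℓ : Line a), r (quotΩ a ℓ) = quot (r a) (sp a ℓ))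
    (hcan : ∀ a : A, (∃ H : Sub (r a), IsEtale H) → ∃ ℓ : Line a, sp a ℓ = kerF (r a))
    (hHF : ∀ (a : A) (ℓ : Line a), sp a ℓ = kerF (r a) → r (quotΩ a ℓ) = r (σA a))
    (hss : ∀ a : A, (∀ H : Sub (r a), ¬ IsEtale H) → quot (r a) (kerF (r a)) = Fr (r a)) (a : A) :
    quot (r a) (kerF (r a)) = Fr (r a) := by
  by_cases hord : ∃ H : Sub (r a), IsEtale H
  · obtain ⟨ℓ, hℓ⟩ := hcan a hord
    rw [← hℓ, ← red_quotΩ, hHF a ℓ hℓ, hread]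
  · exact hss a (fun H hH => hord ⟨H, hH⟩)

/-- **(c3a) EVERYWHERE from HEART-FROB′ on one sheet** (LEAD M-12b (c): «HEART-FROB′ is stated on ONE sheet (image of `red₀ ∘ ℓ_e`)
and transported to all of `P₀` by θ-equivariance + SHEET-COVER»): `quot_kerF_reading_of_heartFrob'` on the image of `r`, then
`quot_kerF_of_cover`. [cite: Liu2021, Prop. D.8 (3) p. 135, pp. 137–138] [cite: SGA1, Exp. V §1] -/
theorem quot_kerF_of_heartFrob' (act : Γ → P → P) (hcover : ∀ x : P, ∃ (γ : Γ) (a : A), x = act γ (r a))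
    (smap : ∀ (γ : Γ) (x : P), Sub x → Sub (act γ x))
    (Fr : P → P) (hFr : ∀ (γ : Γ) (x : P), Fr (act γ x) = act γ (Fr x))
    (σA : A → A) (hread : ∀ a : A, Fr (r a) = r (σA a))
    (kerF : ∀ x : P, Sub x) (hkerF : ∀ (γ : Γ) (x : P), kerF (act γ x) = smap γ x (kerF x))
    (quot : ∀ x : P, Sub x → P) (hquot : ∀ (γ : Γ) (x : P) (H : Sub x), quot (act γ x) (smap γ x H) = act γ (quot x H))
    (IsEtale : ∀ ⦃x : P⦄, Sub x → Prop)
    (sp : ∀ a : A, Line a → Sub (r a)) (quotΩ : ∀ a : A, Line a → A)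
    (red_quotΩ : ∀ (a : A) (ℓ : Line a), r (quotΩ a ℓ) = quot (r a) (sp a ℓ))
    (hcan : ∀ a : A, (∃ H : Sub (r a), IsEtale H) → ∃ ℓ : Line a, sp a ℓ = kerF (r a))
    (hHF : ∀ (a : A) (ℓ : Line a), sp a ℓ = kerF (r a) → r (quotΩ a ℓ) = r (σA a))
    (hss : ∀ a : A, (∀ H : Sub (r a), ¬ IsEtale H) → quot (r a) (kerF (r a)) = Fr (r a)) (x : P) :
    quot x (kerF x) = Fr x :=
  quot_kerF_of_cover act r smap hcover Fr hFr kerF hkerF quot hquot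
    (quot_kerF_reading_of_heartFrob' r Fr σA hread kerF quot IsEtale sp quotΩ red_quotΩ hcan hHF hss) x

end OneSheet

end SheetTransport

end Literature.AlgebraicGeometry.Motives
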